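import Mathlib.Analysis.SpecialFunctions.Pow.Real
import Mathlib.Analysis.SpecialFunctions.Log.Basic
import Mathlib.Analysis.PSeries
import Mathlib.Topology.Algebra.InfiniteSum.NatInt
import Mathlib.Topology.Algebra.InfiniteSum.Real
import HarnessLib

/-!
# Elementary sums over the segments `|t − n/10| ≤ 1/20`: `∑_n log²(|n/10|+4)/(1+(n/10)²) < ∞` and
# `∑_n log²(|n/10|+4) min(12/(1+(n/10)²), θ²) ≪ θ (1 + log(1/θ))²`

Topic `Literature/NumberTheory/LFunctions` (bookkeeping for mean values on vertical lines cut into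
the segments `S_n`, `n ∈ ℤ`, of `ResidueClassRieszMeanLogFree.lean`). Everything here is PROVED and
elementary: the tails `∑_{k > N} k^{-2} ≤ 1/N`, `∑_{k > N} k^{-3/2} ≤ 2/√N` by telescoping, the
bound `log y ≤ 4 y^{1/4}` (Mathlib's `Real.log_le_rpow_div`), and the rescaling
`log(|n|/10 + 4) ≤ log(|n|θ/10 + 4) + log(1/θ + 1)`, which is what makes the second sum linear in
`θ` (the mean square of a multiplicative short-interval difference of length `θ` must be `≪ θ` up to
logarithms). All statements are tagged folklore.
-/

noncomputable section

open Real Finset Filter Topology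

namespace Literature.NumberTheory.LFunctions.SegmentWeights

/-! ### Telescoping tails -/

/-- `∑_{m ≥ 0} 1/(m + N + 1)² ≤ 1/N` for `N ≥ 1` (`1/k² ≤ 1/(k−1) − 1/k`). [folklore] -/
theorem tsum_inv_sq_tail_le {N : ℕ} (hN : 1 ≤ N) :
    ∑' m : ℕ, (1 : ℝ) / ((m + N + 1 : ℕ) : ℝ) ^ 2 ≤ 1 / N := by
  have hN0 : (0 : ℝ) < N := by exact_mod_cast hN
  refine Real.tsum_le_of_sum_range_le (fun m ↦ by positivity) fun M ↦ ?_
  have hterm : ∀ m : ℕ, (1 : ℝ) / ((m + N + 1 : ℕ) : ℝ) ^ 2 ≤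
      1 / ((m + N : ℕ) : ℝ) - 1 / ((m + N + 1 : ℕ) : ℝ) := by
    intro m
    have h1 : (1 : ℝ) ≤ ((m + N : ℕ) : ℝ) := by exact_mod_cast (hN.trans (Nat.le_add_left N m))
    have h2 : ((m + N + 1 : ℕ) : ℝ) = ((m + N : ℕ) : ℝ) + 1 := by push_cast; ring
    rw [h2, div_sub_div _ _ (by positivity) (by positivity), div_le_div_iff₀ (by positivity) (by positivity)]
    nlinarith
  have htel : ∀ M : ℕ, ∑ m ∈ range M, (1 / ((m + N : ℕ) : ℝ) - 1 / ((m + N + 1 : ℕ) : ℝ)) =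
      1 / (N : ℝ) - 1 / ((M + N : ℕ) : ℝ) := by
    intro M
    induction M with
    | zero => simp
    | succ M ih =>
        rw [sum_range_succ, ih]
        have : ((M + 1 + N : ℕ) : ℝ) = ((M + N + 1 : ℕ) : ℝ) := by push_cast; ring
        rw [this]
        ring
  calc ∑ m ∈ range M, (1 : ℝ) / ((m + N + 1 : ℕ) : ℝ) ^ 2
      ≤ ∑ m ∈ range M, (1 / ((m + N : ℕ) : ℝ) - 1 / ((m + N + 1 : ℕ) : ℝ)) := sum_le_sum fun m _ ↦ hterm m
    _ = 1 / (N : ℝ) - 1 / ((M + N : ℕ) : ℝ) := htel M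
    _ ≤ 1 / N := by
        have : (0 : ℝ) ≤ 1 / ((M + N : ℕ) : ℝ) := by positivity
        linarith

/-- `∑_{m ≥ 0} (m + N + 1)^{-3/2} ≤ 2/√N` for `N ≥ 1` (`k^{-3/2} ≤ 2(1/√(k−1) − 1/√k)`). [folklore] -/
theorem tsum_rpow_tail_le {N : ℕ} (hN : 1 ≤ N) :
    ∑' m : ℕ, ((m + N + 1 : ℕ) : ℝ) ^ (-(3 / 2 : ℝ)) ≤ 2 / Real.sqrt N := by
  have hN0 : (0 : ℝ) < N := by exact_mod_cast hN
  refine Real.tsum_le_of_sum_range_le (fun m ↦ by positivity) fun M ↦ ?_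
  -- the telescoping inequality `k^{-3/2} ≤ 2 (1/√(k-1) − 1/√k)` for `k = j + 1`, `j ≥ 1`
  have hterm : ∀ m : ℕ, ((m + N + 1 : ℕ) : ℝ) ^ (-(3 / 2 : ℝ)) ≤
      2 * (1 / Real.sqrt ((m + N : ℕ) : ℝ) - 1 / Real.sqrt ((m + N + 1 : ℕ) : ℝ)) := by
    intro m
    set j : ℝ := ((m + N : ℕ) : ℝ) with hj
    have hj1 : 1 ≤ j := by rw [hj]; exact_mod_cast (hN.trans (Nat.le_add_left N m))
    have hj0 : 0 < j := by linarith
    have hk : ((m + N + 1 : ℕ) : ℝ) = j + 1 := by rw [hj]; push_cast; ring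
    rw [hk]
    have hk0 : 0 < j + 1 := by linarith
    set a : ℝ := Real.sqrt j with ha
    set b : ℝ := Real.sqrt (j + 1) with hb
    have ha0 : 0 < a := Real.sqrt_pos.2 hj0
    have hb0 : 0 < b := Real.sqrt_pos.2 hk0
    have ha2 : a ^ 2 = j := Real.sq_sqrt hj0.le
    have hb2 : b ^ 2 = j + 1 := Real.sq_sqrt hk0.le
    have hab : a ≤ b := Real.sqrt_le_sqrt (by linarith)
    -- `(j+1)^{-3/2} = 1/b³`
    have hpow : (j + 1) ^ (-(3 / 2 : ℝ)) = 1 / b ^ 3 := by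
      rw [Real.rpow_neg hk0.le, one_div, show (3 / 2 : ℝ) = (1 / 2 : ℝ) * (3 : ℕ) by norm_num,
        Real.rpow_mul_natCast hk0.le (1 / 2) 3, ← Real.sqrt_eq_rpow, hb]
    rw [hpow]
    -- `1/b³ ≤ 2(1/a − 1/b) = 2(b − a)/(ab)`, i.e. `a ≤ 2 b² (b − a)`; and `b² (b − a) ≥ b²/(2b) = b/2 ≥ a/2`
    rw [div_sub_div _ _ ha0.ne' hb0.ne', one_mul, mul_one, ← mul_div_assoc,
      div_le_div_iff₀ (by positivity) (by positivity)]
    -- goal: `1 * (a * b) ≤ 2 * (b - a) * b ^ 3`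
    have hdiff : (b - a) * (b + a) = 1 := by nlinarith
    have hba : b - a = 1 / (b + a) := by
      field_simp
      linarith [hdiff]
    have h1 : 1 ≤ 2 * (b - a) * b := by
      rw [hba]
      rw [show 2 * (1 / (b + a)) * b = 2 * b / (b + a) by ring, le_div_iff₀ (by positivity)]
      linarith
    nlinarith [mul_le_mul_of_nonneg_right h1 (by positivity : (0 : ℝ) ≤ a * b),
      mul_le_mul_of_nonneg_left hab (by positivity : (0 : ℝ) ≤ b ^ 2)]
  have htel : ∀ M : ℕ, ∑ m ∈ range M,
      (1 / Real.sqrt ((m + N : ℕ) : ℝ) - 1 / Real.sqrt ((m + N + 1 : ℕ) : ℝ)) =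
      1 / Real.sqrt N - 1 / Real.sqrt ((M + N : ℕ) : ℝ) := by
    intro M
    induction M with
    | zero => simp
    | succ M ih =>
        rw [sum_range_succ, ih]
        have : ((M + 1 + N : ℕ) : ℝ) = ((M + N + 1 : ℕ) : ℝ) := by push_cast; ring
        rw [this]
        ring
  calc ∑ m ∈ range M, ((m + N + 1 : ℕ) : ℝ) ^ (-(3 / 2 : ℝ))
      ≤ ∑ m ∈ range M, 2 * (1 / Real.sqrt ((m + N : ℕ) : ℝ) - 1 / Real.sqrt ((m + N + 1 : ℕ) : ℝ)) :=
        sum_le_sum fun m _ ↦ hterm m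
    _ = 2 * (1 / Real.sqrt N - 1 / Real.sqrt ((M + N : ℕ) : ℝ)) := by rw [← mul_sum, htel M]
    _ ≤ 2 / Real.sqrt N := by
        have : (0 : ℝ) ≤ 1 / Real.sqrt ((M + N : ℕ) : ℝ) := by positivity
        rw [div_eq_mul_one_div 2]
        linarith

/-! ### Sums over `ℤ` of even non-negative sequences -/

/-- For an even non-negative sequence on `ℤ` which is summable on `ℕ`:
`∑_{n ∈ ℤ} f(n) ≤ 2 ∑_{n ∈ ℕ} f(n)`. [folklore] -/
theorem tsum_int_le_two_mul_tsum_nat {f : ℤ → ℝ} (hf : ∀ n, 0 ≤ f n) (heven : ∀ n, f (-n) = f n)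
    (hs : Summable fun n : ℕ ↦ f n) : ∑' n : ℤ, f n ≤ 2 * ∑' n : ℕ, f n := by
  have hs2 : Summable fun n : ℕ ↦ f (-(n + 1 : ℤ)) := by
    have : (fun n : ℕ ↦ f (-(n + 1 : ℤ))) = fun n : ℕ ↦ f ((n + 1 : ℕ) : ℤ) := by
      funext n; rw [heven]; push_cast; rfl
    rw [this]
    exact (summable_nat_add_iff 1).2 hs
  have hs2' : Summable fun n : ℕ ↦ f (-((n : ℤ) + 1)) := hs2
  rw [tsum_of_nat_of_neg_add_one hs hs2']
  have h2 : ∑' n : ℕ, f (-((n : ℤ) + 1)) ≤ ∑' n : ℕ, f n := by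
    have heq : (fun n : ℕ ↦ f (-((n : ℤ) + 1))) = fun n : ℕ ↦ f ((n + 1 : ℕ) : ℤ) := by
      funext n; rw [heven]; push_cast; rfl
    rw [heq]
    have h := hs.sum_add_tsum_nat_add 1
    have h0 : 0 ≤ ∑ i ∈ range 1, f (i : ℤ) := sum_nonneg fun i _ ↦ hf i
    have : ∑' n : ℕ, f ((n + 1 : ℕ) : ℤ) = ∑' n : ℕ, f (((n + 1 : ℕ) : ℤ)) := rfl
    linarith [h]
  linarith

/-- Summability on `ℤ` from summability on `ℕ` for an even sequence. [folklore] -/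
theorem summable_int_of_even {f : ℤ → ℝ} (heven : ∀ n, f (-n) = f n)
    (hs : Summable fun n : ℕ ↦ f n) : Summable f := by
  have hs2 : Summable fun n : ℕ ↦ f (-((n : ℤ) + 1)) := by
    have : (fun n : ℕ ↦ f (-((n : ℤ) + 1))) = fun n : ℕ ↦ f ((n + 1 : ℕ) : ℤ) := by
      funext n; rw [heven]; push_cast; rfl
    rw [this]
    exact (summable_nat_add_iff 1).2 hs
  exact Summable.of_nat_of_neg_add_one hs hs2

/-! ### `log y ≤ 4 y^{1/4}` and the segment weight `log²(|T| + 4)` -/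

/-- `log(y) ≤ 4 y^{1/4}` for `y ≥ 0`. [folklore] -/
theorem log_le_four_mul_rpow_quarter {y : ℝ} (hy : 0 ≤ y) : Real.log y ≤ 4 * y ^ (1 / 4 : ℝ) := by
  have h := Real.log_le_rpow_div hy (by norm_num : (0 : ℝ) < 1 / 4)
  linarith [h, show y ^ (1 / 4 : ℝ) / (1 / 4) = 4 * y ^ (1 / 4 : ℝ) by ring]

/-- `log²(y + 4) ≤ 16 (y + 4)^{1/2}` for `y ≥ 0`. [folklore] -/
theorem log_sq_le {y : ℝ} (hy : 0 ≤ y) : Real.log (y + 4) ^ 2 ≤ 16 * (y + 4) ^ (1 / 2 : ℝ) := by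
  have h0 : 0 ≤ Real.log (y + 4) := Real.log_nonneg (by linarith)
  have h1 := log_le_four_mul_rpow_quarter (y := y + 4) (by linarith)
  have h2 : ((y + 4) ^ (1 / 4 : ℝ)) ^ 2 = (y + 4) ^ (1 / 2 : ℝ) := by
    rw [← Real.rpow_two, ← Real.rpow_mul (by linarith)]
    norm_num
  calc Real.log (y + 4) ^ 2 ≤ (4 * (y + 4) ^ (1 / 4 : ℝ)) ^ 2 := pow_le_pow_left₀ h0 h1 2
    _ = 16 * (y + 4) ^ (1 / 2 : ℝ) := by rw [mul_pow, h2]; norm_num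

/-! ### The first weight: `∑_n log²(|n/10| + 4)/(1 + (n/10)²) < ∞` -/

/-- The even, non-negative weight `W₂(n) = log²(|n/10| + 4) · (1 + (n/10)²)⁻¹`. [folklore] -/
def W₂ (n : ℤ) : ℝ := Real.log (|(n : ℝ) / 10| + 4) ^ 2 * (1 + ((n : ℝ) / 10) ^ 2)⁻¹

/-- `W₂ ≥ 0`. [folklore] -/
theorem W₂_nonneg (n : ℤ) : 0 ≤ W₂ n := by unfold W₂; positivity

/-- `W₂` is even. [folklore] -/
theorem W₂_neg (n : ℤ) : W₂ (-n) = W₂ n := by simp [W₂, abs_neg, neg_div]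

/-- `W₂(n) ≤ 6400 (n + 1)^{-3/2}` for `n ∈ ℕ`. [folklore] -/
theorem W₂_nat_le (n : ℕ) : W₂ n ≤ 6400 * ((n + 1 : ℕ) : ℝ) ^ (-(3 / 2 : ℝ)) := by
  unfold W₂
  have hn0 : (0 : ℝ) ≤ n := Nat.cast_nonneg n
  have habs : |((n : ℤ) : ℝ) / 10| = (n : ℝ) / 10 := by
    rw [Int.cast_natCast, abs_of_nonneg (by positivity)]
  rw [habs, Int.cast_natCast]
  have hm : (1 : ℝ) ≤ ((n + 1 : ℕ) : ℝ) := by exact_mod_cast Nat.succ_pos n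
  have hm0 : (0 : ℝ) < ((n + 1 : ℕ) : ℝ) := by linarith
  have hcast : ((n + 1 : ℕ) : ℝ) = (n : ℝ) + 1 := by push_cast; ring
  -- `log²(n/10 + 4) ≤ 16 (n/10 + 4)^{1/2} ≤ 16 · 2 (n+1)^{1/2}`
  have h1 : Real.log ((n : ℝ) / 10 + 4) ^ 2 ≤ 32 * ((n + 1 : ℕ) : ℝ) ^ (1 / 2 : ℝ) := by
    refine (log_sq_le (by positivity)).trans ?_
    have : ((n : ℝ) / 10 + 4) ^ (1 / 2 : ℝ) ≤ (4 * ((n + 1 : ℕ) : ℝ)) ^ (1 / 2 : ℝ) :=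
      Real.rpow_le_rpow (by positivity) (by rw [hcast]; linarith) (by norm_num)
    rw [Real.mul_rpow (by norm_num) hm0.le, show (4 : ℝ) ^ (1 / 2 : ℝ) = 2 by
      rw [show (4 : ℝ) = 2 ^ ((2 : ℕ) : ℝ) by norm_num, ← Real.rpow_mul (by norm_num)]; norm_num] at this
    linarith
  -- `1/(1 + (n/10)²) ≤ 200 (n+1)^{-2}`
  have h2 : (1 + ((n : ℝ) / 10) ^ 2)⁻¹ ≤ 200 * ((n + 1 : ℕ) : ℝ) ^ (-(2 : ℝ)) := by
    rw [Real.rpow_neg hm0.le, Real.rpow_two, hcast, ← div_eq_mul_inv,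
      le_div_iff₀ (by positivity), inv_mul_eq_div, div_le_iff₀ (by positivity)]
    nlinarith [sq_nonneg ((n : ℝ) - 1)]
  calc Real.log ((n : ℝ) / 10 + 4) ^ 2 * (1 + ((n : ℝ) / 10) ^ 2)⁻¹
      ≤ (32 * ((n + 1 : ℕ) : ℝ) ^ (1 / 2 : ℝ)) * (200 * ((n + 1 : ℕ) : ℝ) ^ (-(2 : ℝ))) :=
        mul_le_mul h1 h2 (by positivity) (by positivity)
    _ = 6400 * ((n + 1 : ℕ) : ℝ) ^ (-(3 / 2 : ℝ)) := by
        rw [show (-(3 / 2 : ℝ)) = 1 / 2 + -(2 : ℝ) by norm_num, Real.rpow_add hm0]; ring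

/-- `∑_{n ∈ ℕ} W₂(n) < ∞`. [folklore] -/
theorem summable_W₂_nat : Summable fun n : ℕ ↦ W₂ n := by
  have h : Summable fun n : ℕ ↦ (6400 : ℝ) * ((n + 1 : ℕ) : ℝ) ^ (-(3 / 2 : ℝ)) := by
    have := (Real.summable_nat_rpow.2 (by norm_num : (-(3 / 2 : ℝ)) < -1))
    exact ((summable_nat_add_iff 1).2 this).mul_left 6400
  exact Summable.of_nonneg_of_le (fun n ↦ W₂_nonneg n) W₂_nat_le h

/-- `∑_{n ∈ ℤ} W₂(n) < ∞`. [folklore] -/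
theorem summable_W₂ : Summable W₂ := summable_int_of_even W₂_neg summable_W₂_nat

/-- The constant `S₂ = ∑_{n ∈ ℤ} W₂(n)`. [folklore] -/
def S₂ : ℝ := ∑' n : ℤ, W₂ n

/-- `S₂ ≥ 0`. [folklore] -/
theorem S₂_nonneg : 0 ≤ S₂ := tsum_nonneg W₂_nonneg

/-! ### The second weight: `∑_n log²(|n/10| + 4) min(12/(1 + (n/10)²), θ²) ≪ θ (1 + log(1/θ))²` -/

/-- The even, non-negative weight `W₃(θ, n) = log²(|n/10| + 4) · min(12 (1 + (n/10)²)⁻¹, θ²)`. [folklore] -/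
def W₃ (θ : ℝ) (n : ℤ) : ℝ :=
  Real.log (|(n : ℝ) / 10| + 4) ^ 2 * min (12 * (1 + ((n : ℝ) / 10) ^ 2)⁻¹) (θ ^ 2)

/-- `W₃ ≥ 0`. [folklore] -/
theorem W₃_nonneg (θ : ℝ) (n : ℤ) : 0 ≤ W₃ θ n := by
  unfold W₃
  exact mul_nonneg (sq_nonneg _) (le_min (by positivity) (sq_nonneg _))

/-- `W₃` is even in `n`. [folklore] -/
theorem W₃_neg (θ : ℝ) (n : ℤ) : W₃ θ (-n) = W₃ θ n := by simp [W₃, abs_neg, neg_div]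

/-- `W₃(θ, n) ≤ 12 W₂(n)`; in particular `W₃(θ, ·)` is summable. [folklore] -/
theorem W₃_le (θ : ℝ) (n : ℤ) : W₃ θ n ≤ 12 * W₂ n := by
  unfold W₃ W₂
  have h0 : 0 ≤ Real.log (|(n : ℝ) / 10| + 4) ^ 2 := sq_nonneg _
  calc Real.log (|(n : ℝ) / 10| + 4) ^ 2 * min (12 * (1 + ((n : ℝ) / 10) ^ 2)⁻¹) (θ ^ 2)
      ≤ Real.log (|(n : ℝ) / 10| + 4) ^ 2 * (12 * (1 + ((n : ℝ) / 10) ^ 2)⁻¹) :=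
        mul_le_mul_of_nonneg_left (min_le_left _ _) h0
    _ = _ := by ring

/-- `W₃(θ, ·)` is summable on `ℕ`. [folklore] -/
theorem summable_W₃_nat (θ : ℝ) : Summable fun n : ℕ ↦ W₃ θ n :=
  Summable.of_nonneg_of_le (fun n ↦ W₃_nonneg θ n) (fun n ↦ W₃_le θ n) (summable_W₂_nat.mul_left 12)

/-- `W₃(θ, ·)` is summable on `ℤ`. [folklore] -/
theorem summable_W₃ (θ : ℝ) : Summable (W₃ θ) := summable_int_of_even (W₃_neg θ) (summable_W₃_nat θ)

/-- The rescaling bound: for `0 < θ ≤ 1` and `y ≥ 0`,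
`log(y + 4) ≤ log(θy + 4) + log(1/θ + 1)` (since `y + 4 ≤ (θy + 4)(1/θ + 1)`). [folklore] -/
theorem log_add_four_le {θ y : ℝ} (hθ : 0 < θ) (hy : 0 ≤ y) :
    Real.log (y + 4) ≤ Real.log (θ * y + 4) + Real.log (1 / θ + 1) := by
  rw [← Real.log_mul (by positivity) (by positivity)]
  refine Real.log_le_log (by positivity) ?_
  have : (θ * y + 4) * (1 / θ + 1) = y + θ * y + 4 / θ + 4 := by field_simp; ring
  rw [this]
  have : 0 ≤ 4 / θ := by positivity
  nlinarith

/-- **Head of the sum**: for `n ≤ N` each term of `∑ W₃(θ, n)` is at most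
`θ² log²(N/10 + 4)`. [folklore] -/
theorem W₃_nat_le_head {θ : ℝ} {n N : ℕ} (hn : n ≤ N) :
    W₃ θ n ≤ θ ^ 2 * Real.log ((N : ℝ) / 10 + 4) ^ 2 := by
  unfold W₃
  have habs : |((n : ℤ) : ℝ) / 10| = (n : ℝ) / 10 := by
    rw [Int.cast_natCast, abs_of_nonneg (by positivity)]
  rw [habs, Int.cast_natCast]
  have hn0 : (0 : ℝ) ≤ (n : ℝ) / 10 := by positivity
  have hlog0 : 0 ≤ Real.log ((n : ℝ) / 10 + 4) := Real.log_nonneg (by linarith)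
  have hnN : (n : ℝ) ≤ N := by exact_mod_cast hn
  have hlogN : Real.log ((n : ℝ) / 10 + 4) ≤ Real.log ((N : ℝ) / 10 + 4) :=
    Real.log_le_log (by positivity) (by linarith)
  calc Real.log ((n : ℝ) / 10 + 4) ^ 2 * min (12 * (1 + ((n : ℝ) / 10) ^ 2)⁻¹) (θ ^ 2)
      ≤ Real.log ((N : ℝ) / 10 + 4) ^ 2 * θ ^ 2 :=
        mul_le_mul (pow_le_pow_left₀ hlog0 hlogN 2) (min_le_right _ _)
          (le_min (by positivity) (sq_nonneg _)) (sq_nonneg _)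
    _ = _ := by ring

/-- **Tail of the sum**: for `0 < θ ≤ 1` and `n ≥ 1` with `θ n ≥ 40`,
`W₃(θ, n) ≤ 2400 (log²(1/θ + 1) n^{-2} + 16 θ^{1/2} n^{-3/2})`. [folklore] -/
theorem W₃_nat_le_tail {θ : ℝ} (hθ : 0 < θ) {n : ℕ} (hn : 1 ≤ n) (hθn : 40 ≤ θ * n) :
    W₃ θ n ≤ 2400 * (Real.log (1 / θ + 1) ^ 2 * (n : ℝ) ^ (-(2 : ℝ)) +
      16 * θ ^ (1 / 2 : ℝ) * (n : ℝ) ^ (-(3 / 2 : ℝ))) := by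
  unfold W₃
  have hn0 : (0 : ℝ) < n := by exact_mod_cast hn
  have habs : |((n : ℤ) : ℝ) / 10| = (n : ℝ) / 10 := by
    rw [Int.cast_natCast, abs_of_nonneg (by positivity)]
  rw [habs, Int.cast_natCast]
  -- the weight: `min(12/(1+(n/10)²), θ²) ≤ 1200 n^{-2}`
  have hw : min (12 * (1 + ((n : ℝ) / 10) ^ 2)⁻¹) (θ ^ 2) ≤ 1200 * (n : ℝ) ^ (-(2 : ℝ)) := by
    refine (min_le_left _ _).trans ?_
    rw [Real.rpow_neg hn0.le, Real.rpow_two, ← div_eq_mul_inv, ← div_eq_mul_inv,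
      div_le_div_iff₀ (by positivity) (by positivity)]
    nlinarith
  have hw0 : 0 ≤ min (12 * (1 + ((n : ℝ) / 10) ^ 2)⁻¹) (θ ^ 2) := le_min (by positivity) (sq_nonneg _)
  -- the logarithm: `log²(n/10 + 4) ≤ 2 log²(θ n/10 + 4) + 2 log²(1/θ + 1)` and
  -- `log²(θn/10 + 4) ≤ 16 (θn/10 + 4)^{1/2} ≤ 16 (θ n / 5)^{1/2} ≤ 16 θ^{1/2} n^{1/2}`
  have hn10 : (0 : ℝ) ≤ (n : ℝ) / 10 := by positivity
  have hl0 : 0 ≤ Real.log ((n : ℝ) / 10 + 4) := Real.log_nonneg (by linarith)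
  have hl1 := log_add_four_le hθ (y := (n : ℝ) / 10) (by positivity)
  have hA0 : 0 ≤ Real.log (θ * ((n : ℝ) / 10) + 4) :=
    Real.log_nonneg (by nlinarith [mul_nonneg hθ.le hn10])
  have hB0 : 0 ≤ Real.log (1 / θ + 1) := Real.log_nonneg (by
    have : 0 < 1 / θ := by positivity
    linarith)
  have hlsq : Real.log ((n : ℝ) / 10 + 4) ^ 2 ≤
      2 * Real.log (θ * ((n : ℝ) / 10) + 4) ^ 2 + 2 * Real.log (1 / θ + 1) ^ 2 := by
    nlinarith [sq_nonneg (Real.log (θ * ((n : ℝ) / 10) + 4) - Real.log (1 / θ + 1)),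
      pow_le_pow_left₀ hl0 hl1 2]
  have hA : Real.log (θ * ((n : ℝ) / 10) + 4) ^ 2 ≤ 16 * (θ ^ (1 / 2 : ℝ) * (n : ℝ) ^ (1 / 2 : ℝ)) := by
    refine (log_sq_le (by positivity)).trans ?_
    have h5 : θ * ((n : ℝ) / 10) + 4 ≤ θ * n := by nlinarith
    have := Real.rpow_le_rpow (by positivity) h5 (by norm_num : (0 : ℝ) ≤ 1 / 2)
    rw [Real.mul_rpow hθ.le hn0.le] at this
    linarith
  calc Real.log ((n : ℝ) / 10 + 4) ^ 2 * min (12 * (1 + ((n : ℝ) / 10) ^ 2)⁻¹) (θ ^ 2)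
      ≤ (2 * Real.log (θ * ((n : ℝ) / 10) + 4) ^ 2 + 2 * Real.log (1 / θ + 1) ^ 2) *
          (1200 * (n : ℝ) ^ (-(2 : ℝ))) := mul_le_mul hlsq hw hw0 (by positivity)
    _ ≤ (2 * (16 * (θ ^ (1 / 2 : ℝ) * (n : ℝ) ^ (1 / 2 : ℝ))) + 2 * Real.log (1 / θ + 1) ^ 2) *
          (1200 * (n : ℝ) ^ (-(2 : ℝ))) := by gcongr
    _ = 2400 * (Real.log (1 / θ + 1) ^ 2 * (n : ℝ) ^ (-(2 : ℝ)) +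
          16 * θ ^ (1 / 2 : ℝ) * ((n : ℝ) ^ (1 / 2 : ℝ) * (n : ℝ) ^ (-(2 : ℝ)))) := by ring
    _ = _ := by
        rw [← Real.rpow_add hn0]
        norm_num

set_option maxHeartbeats 800000 in
/-- **The second weight sum is `≪ θ (1 + log(1/θ))²`.** For `0 < θ ≤ 1`:
`∑_{n ∈ ℤ} log²(|n/10| + 4) · min(12/(1 + (n/10)²), θ²) ≤ 10⁶ θ (1 + log(1/θ + 1))²`.
[folklore] -/
theorem tsum_W₃_le {θ : ℝ} (hθ : 0 < θ) (hθ1 : θ ≤ 1) :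
    ∑' n : ℤ, W₃ θ n ≤ 1000000 * θ * (1 + Real.log (1 / θ + 1)) ^ 2 := by
  -- reduce to `ℕ`
  have hint := tsum_int_le_two_mul_tsum_nat (W₃_nonneg θ) (W₃_neg θ) (summable_W₃_nat θ)
  -- split the sum over `ℕ` at `N = ⌈40/θ⌉`
  set N : ℕ := ⌈40 / θ⌉₊ with hN
  have hN1 : 40 / θ ≤ N := Nat.le_ceil _
  have hN2 : (N : ℝ) < 40 / θ + 1 := Nat.ceil_lt_add_one (by positivity)
  have hNpos : 1 ≤ N := by
    have : (40 : ℝ) ≤ 40 / θ := by rw [le_div_iff₀ hθ]; nlinarith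
    have : (1 : ℝ) ≤ N := by linarith
    exact_mod_cast this
  have hN0 : (0 : ℝ) < N := by exact_mod_cast hNpos
  have hsplit := (summable_W₃_nat θ).sum_add_tsum_nat_add N
  -- head
  have hlogθ : 0 ≤ Real.log (1 / θ + 1) := Real.log_nonneg (by
    have : 0 < 1 / θ := by positivity
    linarith)
  have hhead : ∑ i ∈ range N, W₃ θ i ≤ 41 * θ * (4 + Real.log (1 / θ + 1)) ^ 2 := by
    have hterm : ∀ i ∈ range N, W₃ θ i ≤ θ ^ 2 * Real.log ((N : ℝ) / 10 + 4) ^ 2 := fun i hi ↦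
      W₃_nat_le_head (mem_range.1 hi).le
    refine (sum_le_sum hterm).trans ?_
    rw [sum_const, card_range, nsmul_eq_mul]
    -- `log(N/10 + 4) ≤ log(4/θ + 4.1 + ...) ≤ log(9/θ·...)`: we use `N/10 + 4 ≤ 9 (1/θ + 1)`
    have hL : Real.log ((N : ℝ) / 10 + 4) ≤ 4 + Real.log (1 / θ + 1) := by
      have h1 : (N : ℝ) / 10 + 4 ≤ 9 * (1 / θ + 1) := by
        have : 0 < 1 / θ := by positivity
        have hdiv : (40 : ℝ) / θ = 40 * (1 / θ) := by ring
        linarith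
      calc Real.log ((N : ℝ) / 10 + 4) ≤ Real.log (9 * (1 / θ + 1)) :=
            Real.log_le_log (by positivity) h1
        _ = Real.log 9 + Real.log (1 / θ + 1) := Real.log_mul (by norm_num) (by positivity)
        _ ≤ 4 + Real.log (1 / θ + 1) := by
            have : Real.log 9 ≤ 4 := by
              have := Real.log_le_sub_one_of_pos (show (0 : ℝ) < 9 by norm_num)
              -- `log 9 = 2 log 3 ≤ 2 · 2 = 4`
              have h3 : Real.log 9 = 2 * Real.log 3 := by
                rw [show (9 : ℝ) = 3 ^ 2 by norm_num, Real.log_pow]; norm_num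
              have : Real.log 3 ≤ 2 := by
                have := Real.log_le_sub_one_of_pos (show (0 : ℝ) < 3 by norm_num); linarith
              linarith
            linarith
    have hL0 : 0 ≤ Real.log ((N : ℝ) / 10 + 4) := Real.log_nonneg (by linarith [hN0.le])
    calc (N : ℝ) * (θ ^ 2 * Real.log ((N : ℝ) / 10 + 4) ^ 2)
        ≤ (40 / θ + 1) * (θ ^ 2 * (4 + Real.log (1 / θ + 1)) ^ 2) := by
          gcongr
    _ = (40 + θ) * θ * (4 + Real.log (1 / θ + 1)) ^ 2 := by field_simp
    _ ≤ 41 * θ * (4 + Real.log (1 / θ + 1)) ^ 2 := by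
          gcongr
          · linarith
  -- tail
  have h40 : (40 : ℝ) ≤ N * θ := (div_le_iff₀ hθ).1 hN1
  have hNge1 : (1 : ℝ) ≤ N := by exact_mod_cast hNpos
  have htail : ∑' i : ℕ, W₃ θ (((i + N : ℕ) : ℤ)) ≤
      2400 * (Real.log (1 / θ + 1) ^ 2 * (1 / N) + 16 * θ ^ (1 / 2 : ℝ) * (2 / Real.sqrt N)) * 2 := by
    have hterm : ∀ i : ℕ, W₃ θ (((i + N : ℕ) : ℤ)) ≤
        2400 * (Real.log (1 / θ + 1) ^ 2 * ((i + N : ℕ) : ℝ) ^ (-(2 : ℝ)) +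
          16 * θ ^ (1 / 2 : ℝ) * ((i + N : ℕ) : ℝ) ^ (-(3 / 2 : ℝ))) := by
      intro i
      refine W₃_nat_le_tail hθ (le_trans hNpos (Nat.le_add_left N i)) ?_
      have : (N : ℝ) ≤ ((i + N : ℕ) : ℝ) := by exact_mod_cast Nat.le_add_left N i
      nlinarith [h40, this, hθ.le]
    -- the two tail sums, shifted by one: `∑_i (i+N)^{-2} ≤ N^{-2} + 1/N ≤ 2/N`, etc.; we use the
    -- crude bounds `∑_{i} (i + N)^{-2} = N^{-2} + ∑_m (m+N+1)^{-2} ≤ 1/N² + 1/N ≤ 2/N`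
    have hs1 : Summable fun i : ℕ ↦ ((i + N : ℕ) : ℝ) ^ (-(2 : ℝ)) := by
      have := (Real.summable_nat_rpow.2 (by norm_num : (-(2 : ℝ)) < -1))
      exact (summable_nat_add_iff (f := fun n : ℕ ↦ (n : ℝ) ^ (-(2 : ℝ))) N).2 this
    have hs2 : Summable fun i : ℕ ↦ ((i + N : ℕ) : ℝ) ^ (-(3 / 2 : ℝ)) := by
      have := (Real.summable_nat_rpow.2 (by norm_num : (-(3 / 2 : ℝ)) < -1))
      exact (summable_nat_add_iff (f := fun n : ℕ ↦ (n : ℝ) ^ (-(3 / 2 : ℝ))) N).2 this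
    have ht1 : ∑' i : ℕ, ((i + N : ℕ) : ℝ) ^ (-(2 : ℝ)) ≤ 2 * (1 / N) := by
      rw [hs1.tsum_eq_zero_add]
      have h0 : ((0 + N : ℕ) : ℝ) ^ (-(2 : ℝ)) ≤ 1 / N := by
        rw [zero_add, Real.rpow_neg hN0.le, Real.rpow_two, one_div]
        exact inv_anti₀ hN0 (by nlinarith [hNge1])
      have h1 : ∑' m : ℕ, ((m + 1 + N : ℕ) : ℝ) ^ (-(2 : ℝ)) ≤ 1 / N := by
        have := tsum_inv_sq_tail_le hNpos
        refine le_trans (le_of_eq (tsum_congr fun m ↦ ?_)) this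
        rw [Real.rpow_neg (by positivity), Real.rpow_two, one_div]
        congr 2
        push_cast
        ring
      linarith
    have ht2 : ∑' i : ℕ, ((i + N : ℕ) : ℝ) ^ (-(3 / 2 : ℝ)) ≤ 2 * (2 / Real.sqrt N) := by
      rw [hs2.tsum_eq_zero_add]
      have hsq : Real.sqrt N ≤ N := by
        rw [Real.sqrt_le_left hN0.le]
        nlinarith [hNge1]
      have h0 : ((0 + N : ℕ) : ℝ) ^ (-(3 / 2 : ℝ)) ≤ 2 / Real.sqrt N := by
        rw [zero_add, Real.rpow_neg hN0.le]
        have h32 : Real.sqrt N ≤ (N : ℝ) ^ (3 / 2 : ℝ) := by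
          calc Real.sqrt N = (N : ℝ) ^ (1 / 2 : ℝ) := Real.sqrt_eq_rpow _
            _ ≤ (N : ℝ) ^ (3 / 2 : ℝ) :=
                Real.rpow_le_rpow_of_exponent_le (by exact_mod_cast hNpos) (by norm_num)
        have hspos : 0 < Real.sqrt N := Real.sqrt_pos.2 hN0
        calc ((N : ℝ) ^ (3 / 2 : ℝ))⁻¹ ≤ (Real.sqrt N)⁻¹ := inv_anti₀ hspos h32
          _ = 1 / Real.sqrt N := (one_div _).symm
          _ ≤ 2 / Real.sqrt N := by gcongr; norm_num
      have h1 : ∑' m : ℕ, ((m + 1 + N : ℕ) : ℝ) ^ (-(3 / 2 : ℝ)) ≤ 2 / Real.sqrt N := by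
        have := tsum_rpow_tail_le hNpos
        refine le_trans (le_of_eq (tsum_congr fun m ↦ ?_)) this
        congr 2
        ring
      linarith
    calc ∑' i : ℕ, W₃ θ (((i + N : ℕ) : ℤ))
        ≤ ∑' i : ℕ, 2400 * (Real.log (1 / θ + 1) ^ 2 * ((i + N : ℕ) : ℝ) ^ (-(2 : ℝ)) +
            16 * θ ^ (1 / 2 : ℝ) * ((i + N : ℕ) : ℝ) ^ (-(3 / 2 : ℝ))) := by
          have hsW : Summable fun i : ℕ ↦ W₃ θ (((i + N : ℕ) : ℤ)) :=
            (summable_nat_add_iff (f := fun n : ℕ ↦ W₃ θ (n : ℤ)) N).2 (summable_W₃_nat θ)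
          exact hsW.tsum_le_tsum hterm (((hs1.mul_left _).add (hs2.mul_left _)).mul_left 2400)
      _ = 2400 * (Real.log (1 / θ + 1) ^ 2 * ∑' i : ℕ, ((i + N : ℕ) : ℝ) ^ (-(2 : ℝ)) +
            16 * θ ^ (1 / 2 : ℝ) * ∑' i : ℕ, ((i + N : ℕ) : ℝ) ^ (-(3 / 2 : ℝ))) := by
          rw [tsum_mul_left, (hs1.mul_left _).tsum_add (hs2.mul_left _), tsum_mul_left, tsum_mul_left]
      _ ≤ 2400 * (Real.log (1 / θ + 1) ^ 2 * (2 * (1 / N)) + 16 * θ ^ (1 / 2 : ℝ) * (2 * (2 / Real.sqrt N))) :=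
          mul_le_mul_of_nonneg_left (add_le_add (mul_le_mul_of_nonneg_left ht1 (sq_nonneg _))
            (mul_le_mul_of_nonneg_left ht2 (by positivity))) (by norm_num)
      _ = 2400 * (Real.log (1 / θ + 1) ^ 2 * (1 / N) + 16 * θ ^ (1 / 2 : ℝ) * (2 / Real.sqrt N)) * 2 := by ring
  -- numerical consequences of `N ≥ 40/θ`
  set L : ℝ := Real.log (1 / θ + 1) with hL
  have hN_inv : (1 : ℝ) / N ≤ θ / 40 := by
    rw [div_le_div_iff₀ hN0 (by norm_num)]; linarith
  have hsqrt40 : (6 : ℝ) ≤ Real.sqrt 40 := by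
    rw [Real.le_sqrt (by norm_num) (by norm_num)]; norm_num
  have hθs : 0 < Real.sqrt θ := Real.sqrt_pos.2 hθ
  have hN_sqrt : 1 / Real.sqrt N ≤ Real.sqrt θ / 6 := by
    have h1 : Real.sqrt (40 / θ) ≤ Real.sqrt N := Real.sqrt_le_sqrt hN1
    calc 1 / Real.sqrt N ≤ 1 / Real.sqrt (40 / θ) :=
          one_div_le_one_div_of_le (Real.sqrt_pos.2 (by positivity)) h1
      _ = Real.sqrt θ / Real.sqrt 40 := by
          rw [Real.sqrt_div' 40 hθ.le, one_div_div]
      _ ≤ Real.sqrt θ / 6 := div_le_div_of_nonneg_left hθs.le (by norm_num) hsqrt40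
  have hθhalf : θ ^ (1 / 2 : ℝ) = Real.sqrt θ := (Real.sqrt_eq_rpow θ).symm
  have hθsq : Real.sqrt θ * Real.sqrt θ = θ := Real.mul_self_sqrt hθ.le
  have htail' : ∑' i : ℕ, W₃ θ (((i + N : ℕ) : ℤ)) ≤ 120 * θ * L ^ 2 + 25600 * θ := by
    refine htail.trans ?_
    rw [hθhalf]
    have e1 : L ^ 2 * (1 / (N : ℝ)) ≤ L ^ 2 * (θ / 40) := mul_le_mul_of_nonneg_left hN_inv (sq_nonneg _)
    have e2 : 16 * Real.sqrt θ * (2 / Real.sqrt N) ≤ 16 * Real.sqrt θ * (2 * (Real.sqrt θ / 6)) := by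
      have : 2 / Real.sqrt N = 2 * (1 / Real.sqrt N) := by ring
      rw [this]
      gcongr
    nlinarith [e1, e2, hθsq]
  -- assemble
  have hnat : ∑' n : ℕ, W₃ θ n ≤ 41 * θ * (4 + L) ^ 2 + (120 * θ * L ^ 2 + 25600 * θ) := by
    rw [← hsplit]
    exact add_le_add hhead htail'
  calc ∑' n : ℤ, W₃ θ n ≤ 2 * ∑' n : ℕ, W₃ θ n := hint
    _ ≤ 2 * (41 * θ * (4 + L) ^ 2 + (120 * θ * L ^ 2 + 25600 * θ)) := by gcongr
    _ ≤ 1000000 * θ * (1 + L) ^ 2 := by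
        have hL0 : 0 ≤ L := hlogθ
        have e1 : (4 + L) ^ 2 ≤ 16 * (1 + L) ^ 2 := by nlinarith
        have e2 : L ^ 2 ≤ (1 + L) ^ 2 := by nlinarith
        have e3 : (1 : ℝ) ≤ (1 + L) ^ 2 := by nlinarith
        have f1 := mul_le_mul_of_nonneg_left e1 (show (0 : ℝ) ≤ 82 * θ by positivity)
        have f2 := mul_le_mul_of_nonneg_left e2 (show (0 : ℝ) ≤ 240 * θ by positivity)
        have f3 := mul_le_mul_of_nonneg_left e3 (show (0 : ℝ) ≤ 51200 * θ by positivity)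
        have f4 : (0 : ℝ) ≤ θ * (1 + L) ^ 2 := by positivity
        nlinarith [f1, f2, f3, f4]

end Literature.NumberTheory.LFunctions.SegmentWeights

end
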